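import Mathlib.RingTheory.HopfAlgebra.Basic
import Mathlib.RingTheory.Bialgebra.Convolution
import Mathlib.RingTheory.TensorProduct.Maps
import HarnessLib

/-!
# Hopf algebra structure from a functorial group law on points (Yoneda)

Let `K` be a commutative ring and `H` a commutative `K`-algebra. A **functorial group law** on the
corepresentable functor of points `R' ↦ Hom_{K-alg}(H, R')` of the affine `K`-scheme `Spec H`
(group structures on `Hom_{K-alg}(H, R')` for all commutative `K`-algebras `R'`, natural in `R'`)
is the same thing as a structure of commutative Hopf algebra on `H`: the comultiplication is the
product `Δ = p₁ · p₂ : H → H ⊗ H` of the two universal points `p₁, p₂ : H → H ⊗ H`, the counit is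
the unit point `H → K`, and the antipode is the inverse of the universal point `id : H → H`
(Görtz–Wedhorn, *Algebraic Geometry II*, §(27.2) and Def. 27.6; Waterhouse, *Introduction to
affine group schemes*, §1.4). This file carries out this half of the dictionary by pure algebra
(`Literature.NumberTheory.DiophantineGeometry.CorepGroupLaw.toHopfAlgebra`) and shows that, for the resulting Hopf algebra, the given
group law on points *is* Mathlib's convolution product on `WithConv (H →ₐ[K] R')`
(`Literature.NumberTheory.DiophantineGeometry.CorepGroupLaw.toConv_mul`), so that results on the convolution group of a Hopf algebra
(e.g. Deligne's theorem `Literature.NumberTheory.DiophantineGeometry.Deligne.convPow_finrank_eq_one`) apply to it.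

It is used in `Literature/NumberTheory/DiophantineGeometry/AVKernelHopf.lean` to put a Hopf
algebra structure on the affine algebra of the kernel of an isogeny of abelian varieties.

## Design notes

* The group law is recorded as a structure `Literature.CorepGroupLaw K H` quantifying over all
  commutative `K`-algebras `R' : Type u` in the universe of `K` and `H`; only the values
  `R' = K, H, H ⊗ H, H ⊗ (H ⊗ H)` and naturality along the coprojections are used.
* Mathlib already has this dictionary, in bundled categorical form:
  `CategoryTheory.GrpObj.ofRepresentableBy` (`Mathlib/CategoryTheory/Monoidal/Cartesian/Grp.lean`:
  a natural group structure on `Hom(-, X)` in a cartesian monoidal category makes `X` a group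
  object, with multiplication the product of the two projections and inverse the inverse of `𝟙 X`,
  i.e. exactly `Δ = p₁ · p₂` and `S = id⁻¹` as below), applied in the cartesian monoidal category
  `(CommAlgCat K)ᵒᵖ`, composed with the instances `(A : (CommAlgCat R)ᵒᵖ) [MonObj A] :
  Bialgebra R A.unop` (`Mathlib/Algebra/Category/CommBialgCat.lean`) and
  `(A : (CommAlgCat R)ᵒᵖ) [GrpObj A] : HopfAlgebra R A.unop`
  (`Mathlib/Algebra/Category/CommHopfAlgCat.lean`), yields `toHopfAlgebra` from a `CorepGroupLaw`.
  The direct, unbundled re-proof given here (about 150 lines of `AlgHom` algebra) is kept for the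
  following practical reasons, not because Mathlib lacks the mathematics: (a) the user
  (`AVKernelHopf`) produces and consumes an unbundled, single-universe family of group laws on
  `H →ₐ[K] R'`, `R' : Type u`, rather than a presheaf of groups on `(CommAlgCat K)ᵒᵖ` with a
  `RepresentableBy` datum; (b) it wants the instance `HopfAlgebra K H` on `H` itself rather than on
  the carrier of `(op (CommAlgCat.of K H)).unop`; (c) it needs the identification of the given group
  law with Mathlib's convolution product on `WithConv (H →ₐ[K] R')` (`toConv_mul`, `toConv_one`,
  `toConv_inv_mul`) to apply `Literature.NumberTheory.DiophantineGeometry.Deligne.convPow_finrank_eq_one`, and Mathlib's `AlgHom.convGroup`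
  at this pin assumes `[Bialgebra R C]` on the *target* `C`, so for a plain commutative algebra `R'`
  the inverse must be related to convolution by hand (`toConv_inv_mul`). Also used from Mathlib:
  `Bialgebra.ofAlgHom` (bialgebra axioms in `AlgHom` form), `AlgHom.convMul_def`,
  `AlgHom.convOne_def`, `WithConv`.
* Only `mul_assoc`, `one_mul` (left unit) and `inv_mul` (left inverse) are axioms of a
  `CorepGroupLaw`; `mul_one` and `mul_inv` are derived (`CorepGroupLaw.mul_inv`,
  `CorepGroupLaw.mul_one`), as for abstract groups.

## Main statements

* `Literature.NumberTheory.DiophantineGeometry.CorepGroupLaw.toBialgebra`, `Literature.NumberTheory.DiophantineGeometry.CorepGroupLaw.toHopfAlgebra`: the Hopf algebra structure.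
* `Literature.NumberTheory.DiophantineGeometry.CorepGroupLaw.isCocomm`: it is cocommutative if the group law is commutative.
* `Literature.NumberTheory.DiophantineGeometry.CorepGroupLaw.toConv_mul`, `Literature.NumberTheory.DiophantineGeometry.CorepGroupLaw.toConv_one`: the group law is convolution.

## References

* U. Görtz, T. Wedhorn, *Algebraic Geometry II* (2023), §(27.2), (27.2.1) and Definition 27.6
  (PDF p. 800 of the held copy = printed p. 606); commutative affine group schemes ↔
  cocommutative commutative Hopf algebras (PDF p. 801 = printed p. 607).
* W. C. Waterhouse, *Introduction to affine group schemes* (1979), §§1.3–1.4.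
-/

universe u

open TensorProduct WithConv

noncomputable section

namespace Literature.NumberTheory.DiophantineGeometry

/-- A **functorial group law** on the corepresentable functor `R' ↦ Hom_{K-alg}(H, R')` of points
of the affine `K`-scheme `Spec H`: group structures on `Hom_{K-alg}(H, R')` for all commutative
`K`-algebras `R'`, natural in `R'` (axiomatised, as for abstract groups, by associativity, a left
unit and a left inverse). By Yoneda this is the same as a commutative Hopf algebra structure on `H`
(Görtz–Wedhorn II, §(27.2), PDF p. 800 = printed p. 606; Waterhouse, *Affine group schemes*, §1.4). [cite: GortzWedhorn2023, §(27.2) Def. 27.6 (PDF p. 800, printed p. 606)] -/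
structure CorepGroupLaw (K H : Type u) [CommRing K] [CommRing H] [Algebra K H] where
  /-- The product of two `R'`-valued points. -/
  mul : ∀ ⦃R' : Type u⦄ [CommRing R'] [Algebra K R'], (H →ₐ[K] R') → (H →ₐ[K] R') → (H →ₐ[K] R')
  /-- The unit `R'`-valued point. -/
  one : ∀ (R' : Type u) [CommRing R'] [Algebra K R'], H →ₐ[K] R'
  /-- The inverse of an `R'`-valued point. -/
  inv : ∀ ⦃R' : Type u⦄ [CommRing R'] [Algebra K R'], (H →ₐ[K] R') → (H →ₐ[K] R')
  /-- Associativity. -/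
  mul_assoc : ∀ {R' : Type u} [CommRing R'] [Algebra K R'] (x y z : H →ₐ[K] R'),
    mul (mul x y) z = mul x (mul y z)
  /-- Left unit. -/
  one_mul : ∀ {R' : Type u} [CommRing R'] [Algebra K R'] (x : H →ₐ[K] R'), mul (one R') x = x
  /-- Left inverse. -/
  inv_mul : ∀ {R' : Type u} [CommRing R'] [Algebra K R'] (x : H →ₐ[K] R'),
    mul (inv x) x = one R'
  /-- Naturality of the product in `R'`. -/
  comp_mul : ∀ {R' R'' : Type u} [CommRing R'] [Algebra K R'] [CommRing R''] [Algebra K R'']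
    (φ : R' →ₐ[K] R'') (x y : H →ₐ[K] R'), φ.comp (mul x y) = mul (φ.comp x) (φ.comp y)
  /-- Naturality of the unit in `R'`. -/
  comp_one : ∀ {R' R'' : Type u} [CommRing R'] [Algebra K R'] [CommRing R''] [Algebra K R'']
    (φ : R' →ₐ[K] R''), φ.comp (one R') = one R''

namespace CorepGroupLaw

variable {K H : Type u} [CommRing K] [CommRing H] [Algebra K H] (L : CorepGroupLaw K H)

/-- The two coprojections `H → H ⊗ H` (the two universal points of `Spec H × Spec H`). -/
local notation "ι₁" => (Algebra.TensorProduct.includeLeft : H →ₐ[K] H ⊗[K] H)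
local notation "ι₂" => (Algebra.TensorProduct.includeRight : H →ₐ[K] H ⊗[K] H)

/-- The comultiplication `Δ = p₁ · p₂ : H → H ⊗ H`, the product of the two universal points
(Görtz–Wedhorn II, (27.2.1), PDF p. 800 = printed p. 606). [cite: GortzWedhorn2023, §(27.2) (27.2.1) (PDF p. 800, printed p. 606)] -/
def comul : H →ₐ[K] H ⊗[K] H := L.mul ι₁ ι₂

/-- Unfolding of `comul`. [folklore] -/
theorem comul_def : L.comul = L.mul ι₁ ι₂ := rfl

/-- The counit `ε : H → K`, the unit point (Görtz–Wedhorn II, (27.2.1), PDF p. 800).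
[cite: GortzWedhorn2023, §(27.2) (27.2.1) (PDF p. 800, printed p. 606)] -/
def counit : H →ₐ[K] K := L.one K

/-- The antipode `S : H → H`, the inverse of the universal point `id`
(Görtz–Wedhorn II, (27.2.1), PDF p. 800). [cite: GortzWedhorn2023, §(27.2) (27.2.1) (PDF p. 800, printed p. 606)] -/
def antipodeAlgHom : H →ₐ[K] H := L.inv (AlgHom.id K H)

variable {R' : Type u} [CommRing R'] [Algebra K R']

/-- **Right inverse** `x · x⁻¹ = 1`, derived from associativity, the left unit and the left inverse
(`y = x · x⁻¹` is idempotent, and idempotents of a group are trivial). [folklore] -/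
theorem mul_inv (x : H →ₐ[K] R') : L.mul x (L.inv x) = L.one R' := by
  have hy : L.mul (L.mul x (L.inv x)) (L.mul x (L.inv x)) = L.mul x (L.inv x) := by
    rw [L.mul_assoc, ← L.mul_assoc (L.inv x) x, L.inv_mul, L.one_mul]
  calc L.mul x (L.inv x)
      = L.mul (L.one R') (L.mul x (L.inv x)) := (L.one_mul _).symm
    _ = L.mul (L.mul (L.inv (L.mul x (L.inv x))) (L.mul x (L.inv x))) (L.mul x (L.inv x)) := by
        rw [L.inv_mul]
    _ = L.one R' := by rw [L.mul_assoc, hy, L.inv_mul]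

/-- **Right unit** `x · 1 = x`, derived: `x · 1 = x · (x⁻¹ · x) = (x · x⁻¹) · x = 1 · x`. [folklore] -/
theorem mul_one (x : H →ₐ[K] R') : L.mul x (L.one R') = x := by
  rw [← L.inv_mul x, ← L.mul_assoc, L.mul_inv, L.one_mul]

/-- **The group law is convolution**: `x · y = (x ⊗ y) ∘ Δ` (Yoneda). [folklore] -/
theorem mul_eq (x y : H →ₐ[K] R') :
    L.mul x y = (Algebra.TensorProduct.lift x y fun _ _ ↦ .all _ _).comp L.comul := by
  rw [comul_def, L.comp_mul, Algebra.TensorProduct.lift_comp_includeLeft,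
    Algebra.TensorProduct.lift_comp_includeRight']

variable (R') in
/-- The unit point over `R'` is `H → K → R'` (Yoneda). [folklore] -/
theorem one_eq : L.one R' = (Algebra.ofId K R').comp L.counit :=
  (L.comp_one (Algebra.ofId K R')).symm

/-- Naturality of the inverse, `φ ∘ x⁻¹ = (φ ∘ x)⁻¹` (inverses are unique). [folklore] -/
theorem comp_inv {R'' : Type u} [CommRing R''] [Algebra K R''] (φ : R' →ₐ[K] R'')
    (x : H →ₐ[K] R') : φ.comp (L.inv x) = L.inv (φ.comp x) := by
  have h1 : L.mul (φ.comp (L.inv x)) (φ.comp x) = L.one R'' := by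
    rw [← L.comp_mul, L.inv_mul, L.comp_one]
  calc φ.comp (L.inv x)
      = L.mul (φ.comp (L.inv x)) (L.mul (φ.comp x) (L.inv (φ.comp x))) := by
        rw [L.mul_inv, L.mul_one]
    _ = L.inv (φ.comp x) := by rw [← L.mul_assoc, h1, L.one_mul]

/-- The inverse of a point is `x ∘ S` (Yoneda). [folklore] -/
theorem inv_eq (x : H →ₐ[K] R') : L.inv x = x.comp L.antipodeAlgHom := by
  rw [antipodeAlgHom, L.comp_inv, AlgHom.comp_id]

/-! ### Coassociativity and the counit axioms -/

/-- `q₁ a = a ⊗ 1 ⊗ 1`. -/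
local notation "q₁" => (Algebra.TensorProduct.includeLeft : H →ₐ[K] H ⊗[K] (H ⊗[K] H))
/-- `q₂ b = 1 ⊗ b ⊗ 1`. -/
local notation "q₂" =>
  (AlgHom.comp (Algebra.TensorProduct.includeRight : H ⊗[K] H →ₐ[K] H ⊗[K] (H ⊗[K] H)) ι₁)
/-- `q₃ c = 1 ⊗ 1 ⊗ c`. -/
local notation "q₃" =>
  (AlgHom.comp (Algebra.TensorProduct.includeRight : H ⊗[K] H →ₐ[K] H ⊗[K] (H ⊗[K] H)) ι₂)

/-- `(id ⊗ Δ) ∘ Δ = q₁ · (q₂ · q₃)`. [folklore] -/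
theorem coassoc_rhs :
    (Algebra.TensorProduct.map (.id K H) L.comul).comp L.comul = L.mul q₁ (L.mul q₂ q₃) := by
  conv_lhs => rw [comul_def, L.comp_mul, Algebra.TensorProduct.map_comp_includeLeft,
    Algebra.TensorProduct.map_comp_includeRight, AlgHom.comp_id, L.comp_mul]

/-- The coprojection `H ⊗ H → (H ⊗ H) ⊗ H`. -/
local notation "j₁" => (Algebra.TensorProduct.includeLeft : H ⊗[K] H →ₐ[K] (H ⊗[K] H) ⊗[K] H)
/-- The associator `(H ⊗ H) ⊗ H ≃ H ⊗ (H ⊗ H)` as an algebra map. -/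
local notation "assoc₃" => (AlgEquiv.toAlgHom (Algebra.TensorProduct.assoc K K K H H H))

omit L in
/-- `assoc₃ (a ⊗ 1 ⊗ 1) = q₁ a`. [folklore] -/
theorem leaf₁ : ((AlgHom.comp assoc₃ j₁).comp ι₁ : H →ₐ[K] H ⊗[K] (H ⊗[K] H)) = q₁ := by
  ext a
  simp [Algebra.TensorProduct.one_def]

omit L in
/-- `assoc₃ (1 ⊗ b ⊗ 1) = q₂ b`. [folklore] -/
theorem leaf₂ : ((AlgHom.comp assoc₃ j₁).comp ι₂ : H →ₐ[K] H ⊗[K] (H ⊗[K] H)) = q₂ := by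
  ext a
  simp

/-- `assoc₃ ((Δ ⊗ id) (1 ⊗ c)) = q₃ c`. [folklore] -/
theorem leaf₃ :
    ((AlgHom.comp assoc₃ (Algebra.TensorProduct.map L.comul (.id K H))).comp ι₂ :
      H →ₐ[K] H ⊗[K] (H ⊗[K] H)) = q₃ := by
  ext a
  simp [Algebra.TensorProduct.one_def]

/-- `assoc₃ ∘ (Δ ⊗ id) ∘ Δ = (q₁ · q₂) · q₃`. [folklore] -/
theorem coassoc_lhs :
    (AlgHom.comp assoc₃ ((Algebra.TensorProduct.map L.comul (.id K H)).comp L.comul)) =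
      L.mul (L.mul q₁ q₂) q₃ :=
  calc AlgHom.comp assoc₃ ((Algebra.TensorProduct.map L.comul (.id K H)).comp L.comul)
      = (AlgHom.comp assoc₃ (Algebra.TensorProduct.map L.comul (.id K H))).comp (L.mul ι₁ ι₂) := by
        rw [AlgHom.comp_assoc]; rfl
    _ = L.mul ((AlgHom.comp assoc₃ (Algebra.TensorProduct.map L.comul (.id K H))).comp ι₁) q₃ := by
        rw [L.comp_mul, leaf₃]
    _ = L.mul ((AlgHom.comp assoc₃ j₁).comp (L.mul ι₁ ι₂)) q₃ := by
        rw [AlgHom.comp_assoc, Algebra.TensorProduct.map_comp_includeLeft, ← AlgHom.comp_assoc]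
        rfl
    _ = L.mul (L.mul q₁ q₂) q₃ := by rw [L.comp_mul, leaf₁, leaf₂]

/-- **Coassociativity** of `Δ`, from associativity of the group law on
`H ⊗ H ⊗ H`-valued points (Görtz–Wedhorn II, §(27.2)). [cite: GortzWedhorn2023, §(27.2) Def. 27.6 (PDF p. 800, printed p. 606)] -/
theorem coassoc :
    (Algebra.TensorProduct.assoc K K K H H H).toAlgHom.comp
      ((Algebra.TensorProduct.map L.comul (.id K H)).comp L.comul) =
    (Algebra.TensorProduct.map (.id K H) L.comul).comp L.comul := by
  rw [coassoc_lhs, coassoc_rhs, L.mul_assoc]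

/-- **Left counit axiom** `(ε ⊗ id) ∘ Δ = (λ⁻¹ : H → K ⊗ H)`, from `1 · x = x`
(Görtz–Wedhorn II, §(27.2)). [cite: GortzWedhorn2023, §(27.2) Def. 27.6 (PDF p. 800, printed p. 606)] -/
theorem rTensor_counit :
    (Algebra.TensorProduct.map L.counit (.id K H)).comp L.comul =
      (Algebra.TensorProduct.lid K H).symm := by
  conv_lhs => rw [comul_def, L.comp_mul, Algebra.TensorProduct.map_comp_includeLeft,
    Algebra.TensorProduct.map_comp_includeRight, AlgHom.comp_id]
  have h1 : (Algebra.TensorProduct.includeLeft : K →ₐ[K] K ⊗[K] H).comp L.counit =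
      L.one (K ⊗[K] H) := by
    rw [L.one_eq, Subsingleton.elim (Algebra.TensorProduct.includeLeft : K →ₐ[K] K ⊗[K] H)
      (Algebra.ofId K _)]
  rw [h1, L.one_mul]
  ext a
  simp

/-- **Right counit axiom** `(id ⊗ ε) ∘ Δ = (ρ⁻¹ : H → H ⊗ K)`, from `x · 1 = x`
(Görtz–Wedhorn II, §(27.2)). [cite: GortzWedhorn2023, §(27.2) Def. 27.6 (PDF p. 800, printed p. 606)] -/
theorem lTensor_counit :
    (Algebra.TensorProduct.map (.id K H) L.counit).comp L.comul =
      (Algebra.TensorProduct.rid K K H).symm := by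
  conv_lhs => rw [comul_def, L.comp_mul, Algebra.TensorProduct.map_comp_includeLeft,
    Algebra.TensorProduct.map_comp_includeRight, AlgHom.comp_id]
  have h1 : (Algebra.TensorProduct.includeRight : K →ₐ[K] H ⊗[K] K).comp L.counit =
      L.one (H ⊗[K] K) := by
    rw [L.one_eq, Subsingleton.elim (Algebra.TensorProduct.includeRight : K →ₐ[K] H ⊗[K] K)
      (Algebra.ofId K _)]
  rw [h1, L.mul_one]
  ext a
  simp

/-- **The bialgebra structure on `H`** defined by the functorial group law (Yoneda;
Görtz–Wedhorn II, §(27.2)). [cite: GortzWedhorn2023, §(27.2) Def. 27.6 (PDF p. 800, printed p. 606)] -/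
abbrev toBialgebra : Bialgebra K H :=
  Bialgebra.ofAlgHom L.comul L.counit L.coassoc L.rTensor_counit L.lTensor_counit

/-- **Left antipode axiom** `m ∘ (S ⊗ id) ∘ Δ = η ∘ ε`, from `x⁻¹ · x = 1`
(Görtz–Wedhorn II, §(27.2)). [cite: GortzWedhorn2023, §(27.2) Def. 27.6 (PDF p. 800, printed p. 606)] -/
theorem antipode_left :
    (Algebra.TensorProduct.lmul' K (S := H)).comp
      ((Algebra.TensorProduct.map L.antipodeAlgHom (.id K H)).comp L.comul) =
    (Algebra.ofId K H).comp L.counit := by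
  rw [← AlgHom.comp_assoc, Algebra.TensorProduct.lmul'_comp_map, ← mul_eq, ← one_eq, antipodeAlgHom,
    L.inv_mul]

/-- **Right antipode axiom** `m ∘ (id ⊗ S) ∘ Δ = η ∘ ε`, from `x · x⁻¹ = 1`
(Görtz–Wedhorn II, §(27.2)). [cite: GortzWedhorn2023, §(27.2) Def. 27.6 (PDF p. 800, printed p. 606)] -/
theorem antipode_right :
    (Algebra.TensorProduct.lmul' K (S := H)).comp
      ((Algebra.TensorProduct.map (.id K H) L.antipodeAlgHom).comp L.comul) =
    (Algebra.ofId K H).comp L.counit := by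
  rw [← AlgHom.comp_assoc, Algebra.TensorProduct.lmul'_comp_map, ← mul_eq, ← one_eq, antipodeAlgHom,
    L.mul_inv]

/-- **The Hopf algebra structure on `H`** defined by the functorial group law (Yoneda;
Görtz–Wedhorn II, §(27.2): affine group schemes over `R` "are" commutative Hopf `R`-algebras;
Waterhouse §1.4). [cite: GortzWedhorn2023, §(27.2) Def. 27.6 (PDF p. 800, printed p. 606)] -/
abbrev toHopfAlgebra : HopfAlgebra K H :=
  letI := L.toBialgebra
  { antipode := L.antipodeAlgHom.toLinearMap
    mul_antipode_rTensor_comul := congr(($(L.antipode_left)).toLinearMap)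
    mul_antipode_lTensor_comul := congr(($(L.antipode_right)).toLinearMap) }

/-- The Hopf algebra is **cocommutative** if the group law is commutative (Görtz–Wedhorn II,
§(27.2), PDF p. 801 = printed p. 607: "commutative affine group schemes correspond to cocommutative
commutative Hopf algebras"). [cite: GortzWedhorn2023, §(27.2) PDF p. 801 (printed p. 607)] -/
theorem isCocomm (hcomm : ∀ {R' : Type u} [CommRing R'] [Algebra K R'] (x y : H →ₐ[K] R'),
    L.mul x y = L.mul y x) :
    letI := L.toBialgebra; Coalgebra.IsCocomm K H := by
  letI := L.toBialgebra
  refine ⟨?_⟩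
  have h : (Algebra.TensorProduct.comm K H H).toAlgHom.comp L.comul = L.comul := by
    conv_rhs => rw [comul_def, hcomm, mul_eq]
    rw [comul_def]
    congr 1
    exact Algebra.TensorProduct.ext' fun a b ↦ by simp
  exact congr(($h).toLinearMap)

/-- **Points form the convolution monoid**: for the Hopf structure `L.toHopfAlgebra`, the given
group law on `Hom_{K-alg}(H, R')` is Mathlib's convolution product on `WithConv (H →ₐ[K] R')`. [folklore] -/
theorem toConv_mul (x y : H →ₐ[K] R') :
    letI := L.toBialgebra; toConv (L.mul x y) = toConv x * toConv y := by
  letI := L.toBialgebra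
  rw [AlgHom.convMul_def, ofConv_toConv, ofConv_toConv, ← AlgHom.comp_assoc,
    Algebra.TensorProduct.lmul'_comp_map, mul_eq]
  rfl

/-- The unit point is the unit of the convolution monoid. [folklore] -/
theorem toConv_one : letI := L.toBialgebra; toConv (L.one R') = (1 : WithConv (H →ₐ[K] R')) := by
  letI := L.toBialgebra
  rw [AlgHom.convOne_def, one_eq]
  rfl

/-- The inverse of a point is its inverse in the convolution monoid: `x⁻¹ * x = 1`. [folklore] -/
theorem toConv_inv_mul (x : H →ₐ[K] R') :
    letI := L.toBialgebra; toConv (L.inv x) * toConv x = (1 : WithConv (H →ₐ[K] R')) := by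
  rw [← toConv_mul, L.inv_mul, toConv_one]

end CorepGroupLaw

end Literature.NumberTheory.DiophantineGeometry
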